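import Summits.AtomisticToContinuum.BoseEinsteinCondensation.Theorems.BECTangentRigidityRigidMomentumBoundSmearingReduction
import HarnessLib

/-!
# Crux `RigidMomentumBound` (stmt-AtomisticToContinuum-13034), line `registered`:
# stub `stub_rigidMomentumBound_of_displacementSoftness_at` — the `v`-wise reduction of the crux's
# conclusion to displacement softness

Supports (does not close) stmt-AtomisticToContinuum-13034. For ONE repulsive finite-range pair
potential `v`, **displacement softness** of the Dirichlet ground-state energy,
`E₀(N, L_N) ≤ E₀(N, (1+κ/N)L_N) + εN/L_N²` eventually in `N` for all `ε, κ > 0` at small density,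
implies the conclusion of the crux `RigidMomentumBound` for this `v`: near-minimisers `Ψ` in the box
`L_N = (N/ρ)^{1/3}` have total-momentum fluctuation `∑_a ∫|∑ⱼ ∂_{j,a} Ψ|² ≤ ε N²/L_N²`.

This is the pointwise-in-`v` form of the landed `Smearing.rigidMomentumBound_of_displacementSoftness`
(`Theorems/BECTangentRigidityRigidMomentumBoundSmearingReduction.lean`); the proof is the same:
`stub_dirichletEnergyLinear` (finiteness, S1), the smearing bound `Smearing.smearingBound`
`E₀(N, L + 6τ) ≤ E₀^rel(N, L) + 3π²/(4Nτ²)` at `τ := κL_N/(6N)`, `κ² = 108π²/ε`, and König's identity in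
the form of the reduction lemma `sum_lintegral_sq_fderiv_rigid_le_of_energy_le`
(`Literature/MathematicalPhysics/QuantumManyBody/CentreOfMassKineticEnergy.lean`).

References: Lieb–Loss, *Analysis* (2001) Thm 7.8; Cornean–Dereziński–Ziń, J. Math. Phys. 50 (2009)
§2.2 (`H = P²/2nm + H_rel`); LSSY 2005 §5.2 fn 2.
-/

noncomputable section

namespace Summit.AtomisticToContinuum.BoseEinsteinCondensation.Theorems.RigidMomentumBound

open MeasureTheory Filter
open scoped ENNReal NNReal BigOperators
open Literature.MathematicalPhysics.QuantumManyBody.BoseGas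

/-- **The crux's conclusion for one `v` from displacement softness for that `v`.**
For a repulsive finite-range `v` satisfying displacement softness
(`∃ ρ₄ > 0, ∀ ρ ∈ (0, ρ₄), ∀ ε κ > 0, ∀ᶠ N, E₀(N,L_N) ≤ E₀(N,(1+κ/N)L_N) + ofReal (εN/L_N²)`):
`ρ₀ := min ρ₁ ρ₄` (`ρ₁` from `stub_dirichletEnergyLinear`); at `0 < ρ < ρ₀` and `ε > 0` put
`κ := 6π√(3/ε)` (so `κ² = 108π²/ε`); eventually in `N` (`N ≥ 1`, S1: `E₀(N,L_N) ≤ CN`, softness at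
`(ε/4, κ)`): with `τ := κL_N/(6N)` one has `L_N + 6τ = (1+κ/N)L_N` and `3π²/(4Nτ²) = εN/(4L_N²)`, so
softness and the smearing bound give `E₀(N,L_N) ≤ E₀^rel(N,L_N) + εN/(4L²) + εN/(4L²)`; with
`δ := ofReal(εN/(4L²)) > 0` a `δ`-near-minimiser `Ψ` has finite energy `≤ E₀^rel + 3·ofReal(εN/(4L²))`,
hence `⟨Ψ,P²Ψ⟩ ≤ N · 3εN/(4L²) ≤ εN²/L²` by the reduction lemma (König's identity). -/
theorem stub_rigidMomentumBound_of_displacementSoftness_at :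
    ∀ (v : ℝ → ℝ≥0∞), IsRepulsiveFiniteRange v →
      (∃ ρ₄ : ℝ, 0 < ρ₄ ∧ ∀ ρ : ℝ, 0 < ρ → ρ < ρ₄ →
        ∀ ε : ℝ, 0 < ε → ∀ κ : ℝ, 0 < κ → ∀ᶠ N : ℕ in atTop,
          groundStateEnergy v N (sideLength ρ N) ≤
            groundStateEnergy v N ((1 + κ / N) * sideLength ρ N) +
              ENNReal.ofReal (ε * N / sideLength ρ N ^ 2)) →
      ∃ ρ₀ : ℝ, 0 < ρ₀ ∧ ∀ ρ : ℝ, 0 < ρ → ρ < ρ₀ → ∀ ε : ℝ, 0 < ε → ∀ᶠ N : ℕ in atTop,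
        ∃ δ : ℝ≥0∞, 0 < δ ∧ ∀ Ψ : TrialState N (sideLength ρ N),
          energy v Ψ ≤ groundStateEnergy v N (sideLength ρ N) + δ →
            ∑ a : Fin 3, ∫⁻ X, (‖fderiv ℝ Ψ.ψ X (fun _ : Fin N => EuclideanSpace.single a (1 : ℝ))‖₊ : ℝ≥0∞) ^ 2
              ≤ ENNReal.ofReal (ε * (N : ℝ) ^ 2 / sideLength ρ N ^ 2) := by
  -- adapted from Theorems/BECTangentRigidityRigidMomentumBoundSmearingReduction.lean
  -- (`Smearing.rigidMomentumBound_of_displacementSoftness`), with `hS4 v hv` replaced by `hS4v`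
  intro v hv hS4v
  obtain ⟨ρ₁, hρ₁, h₁⟩ := RigidMomentumBound.stub_dirichletEnergyLinear v hv
  obtain ⟨ρ₄, hρ₄, h₄⟩ := hS4v
  refine ⟨min ρ₁ ρ₄, lt_min hρ₁ hρ₄, fun ρ hρ hρlt ε hε => ?_⟩
  obtain ⟨C, _, hE₀⟩ := h₁ ρ hρ (hρlt.trans_le (min_le_left _ _))
  set κ : ℝ := 6 * Real.pi * Real.sqrt (3 / ε) with hκ
  have hκpos : 0 < κ := by positivity
  have hS := h₄ ρ hρ (hρlt.trans_le (min_le_right _ _)) (ε / 4) (by positivity) κ hκpos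
  filter_upwards [hE₀, hS, eventually_gt_atTop 0] with N hN₁ hN₄ hN0
  have hNpos : (0 : ℝ) < N := Nat.cast_pos.2 hN0
  have hLpos : 0 < sideLength ρ N := Real.rpow_pos_of_pos (div_pos hNpos hρ) _
  set L := sideLength ρ N with hLdef
  set η : ℝ≥0∞ := ENNReal.ofReal (ε / 4 * N / L ^ 2) with hη
  have hηpos : 0 < η := ENNReal.ofReal_pos.2 (by positivity)
  refine ⟨η, hηpos, fun Ψ hΨ => ?_⟩
  -- the smearing bound at `τ := κ L /(6 N)`
  set τ : ℝ := κ * L / (6 * N) with hτdef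
  have hτ : 0 < τ := by positivity
  have hsm := Smearing.smearingBound v hv.1 N L τ hτ
  have hL6 : L + 6 * τ = (1 + κ / N) * L := by
    rw [hτdef]; field_simp
  have hsq : Real.sqrt (3 / ε) ^ 2 = 3 / ε := Real.sq_sqrt (by positivity)
  have hconst : 3 * Real.pi ^ 2 / (4 * N * τ ^ 2) = ε / 4 * N / L ^ 2 := by
    rw [hτdef, hκ]
    field_simp
    rw [hsq]
    field_simp
  rw [hL6, hconst, ← hη] at hsm
  -- `E₀(L) ≤ E₀^rel(L) + η + η`
  have hE₀rel : groundStateEnergy v N L ≤ relGroundStateEnergy v N L + (η + η) :=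
    calc groundStateEnergy v N L ≤ groundStateEnergy v N ((1 + κ / N) * L) + η := hN₄
      _ ≤ relGroundStateEnergy v N L + η + η := by gcongr
      _ = _ := by rw [add_assoc]
  -- finiteness of the energy of the near-minimiser (from S1)
  have hEfin : energy v Ψ ≠ ⊤ :=
    ne_top_of_le_ne_top (ENNReal.add_ne_top.2 ⟨ENNReal.ofReal_ne_top, ENNReal.ofReal_ne_top⟩)
      (hΨ.trans (add_le_add hN₁ le_rfl))
  have h3 : energy v Ψ ≤ relGroundStateEnergy v N L + (η + η + η) :=
    calc energy v Ψ ≤ groundStateEnergy v N L + η := hΨ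
      _ ≤ relGroundStateEnergy v N L + (η + η) + η := by gcongr
      _ = _ := by rw [add_assoc]
  calc ∑ a : Fin 3, ∫⁻ X,
          (‖fderiv ℝ Ψ.ψ X (fun _ : Fin N => EuclideanSpace.single a (1 : ℝ))‖₊ : ℝ≥0∞) ^ 2
        ≤ (N : ℝ≥0∞) * (η + η + η) := sum_lintegral_sq_fderiv_rigid_le_of_energy_le v Ψ hEfin h3
    _ = ENNReal.ofReal (3 * ε / 4 * (N : ℝ) ^ 2 / L ^ 2) := by
          rw [hη, ← ENNReal.ofReal_add (by positivity) (by positivity),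
            ← ENNReal.ofReal_add (by positivity) (by positivity), ← ENNReal.ofReal_natCast,
            ← ENNReal.ofReal_mul hNpos.le]
          congr 1
          field_simp
          ring
    _ ≤ ENNReal.ofReal (ε * (N : ℝ) ^ 2 / L ^ 2) := by
          refine ENNReal.ofReal_le_ofReal ?_
          rw [div_le_div_iff_of_pos_right (by positivity)]
          nlinarith [sq_nonneg (N : ℝ), hε, mul_nonneg hε.le (sq_nonneg (N : ℝ))]

end Summit.AtomisticToContinuum.BoseEinsteinCondensation.Theorems.RigidMomentumBound

end
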